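import Summits.QuantumFields.YangMills.Theorems.PoincareLipschitzHierAlignPotential
import Summits.QuantumFields.YangMills.Theorems.PoincareLipschitzHierAlignSharpLemmas
import HarnessLib

/-!
# Crux stmt-QuantumFields-19936 `HistoryTailL` — S-ALIGN brick D: THE CORNER DATA OF ONE COARSE CELL
# (rooted potentials at the `2^d` corners `z₀ + ε`: size, one-edge differences, change of root, the root edge)

Cell `ym3-torus` (rung R3 = YM₃ on T³ — a RUNG, NOT the Clay problem), width seat `ym-ust-19936-w3` gen 12, `--supports stmt-QuantumFields-19936 --as helper`.
Summons w2 g11 02:42:44Z «w3 g12: S-ALIGN».  Everything the smoothing gauge reads off the COARSE field `G` lives on one cell: its corners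
`z₀ + ε` (`ε ∈ {0,1}^d`, written `i ↦ z₀ i + (if ε i then 1 else 0)`), a root corner `r`, the per-root small-link gauges `κ r` (hypothesis: on the
unit cube around `r`, `G` is `X`-small and `G^{κ r}` is `w`-small), and the rooted potentials `U_r(z) = κ_r(r)⁻¹ κ_r(z)` with their guarded logarithms.
THIS FILE (def-free, `SU(N)`):
* `dist1_cornerPotential_le` — `dist1 U_r(z₀+ε) ≤ d(X+w)` (✓brick P);
* ★ `norm_glog_corner_edge_sub_le` — along a cell edge `ε → ε[μ↦1]`: `‖glog U_r(z₀+ε[μ↦1]) − glog U_r(z₀+ε)‖ ≤ q + 2q² + 4(Y+q)²`, `q = X+2w`,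
  `Y = d(X+w)` — THE FIRST-ORDER SIZE IS ONE LINK `X`;
* ★ `norm_glog_corner_root_change_le` — moving the root along the edge `r → r' = r + e_μ`: `glog U_r(z) = glog U_r(r') + glog U_{r'}(z) + O(dw + Y²)`;
* `exists_rootEdge_factor` — `G⟨r, μ⟩ = M⁻¹·U_r(r')` with `dist1 M ≤ w`, and `dist1 U_r(r') ≤ X + w`.
-/

noncomputable section

open scoped BigOperators Matrix.Norms.L2Operator
open NormedSpace

namespace Summit.QuantumFields.YangMills.Theorems.PoincareLipschitzHierAlignCornerData

open Literature.MathematicalPhysics.QuantumFieldTheory.Balaban1983to89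
open Literature.MathematicalPhysics.QuantumFieldTheory.Balaban1983to89.MatrixLog (mlog)
open Summit.QuantumFields.YangMills.Theorems.PoincareLipschitzHierAlignPotential
open Summit.QuantumFields.YangMills.Theorems.PoincareLipschitzHierAlignSharpLemmas

variable {P : Params} {k : ℕ} {n : Type*} [Fintype n] [DecidableEq n] [Nonempty n]

/-! ## §1 Corners lie in the unit cube around any corner -/

/-- `dist1 (a⁻¹ g⁻¹ a) = dist1 g`. [folklore] -/
theorem dist1_inv_mul_inv_mul {G : Type*} [GaugeGroup G] (a g : G) : dist1 (a⁻¹ * g⁻¹ * a) = dist1 g := by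
  have h := GaugeGroup.dist1_conj g⁻¹ a⁻¹
  rw [inv_inv] at h
  rw [h, GaugeGroup.dist1_inv]

/-- A corner `z₀ + ε` is in the unit cube around the corner `z₀ + ε₁` (offset `[ε] − [ε₁] ∈ {−1,0,1}`). [folklore] -/
theorem corner_offset (z₀ : Site P k) (ε₁ ε : Fin P.d → Bool) (i : Fin P.d) :
    (z₀ i + (if ε i then 1 else 0) : ZMod (P.sitesPerDir k)) =
      (z₀ i + (if ε₁ i then 1 else 0)) +
        ((((if ε i then (1 : ℤ) else 0) - (if ε₁ i then (1 : ℤ) else 0) : ℤ)) : ZMod (P.sitesPerDir k)) := by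
  push_cast
  split_ifs <;> ring

/-- The offsets `[ε] − [ε₁]` are in `{−1, 0, 1}`. [folklore] -/
theorem corner_offset_cases (ε₁ ε : Fin P.d → Bool) (i : Fin P.d) :
    ((if ε i then (1 : ℤ) else 0) - (if ε₁ i then (1 : ℤ) else 0)) = -1 ∨
      ((if ε i then (1 : ℤ) else 0) - (if ε₁ i then (1 : ℤ) else 0)) = 0 ∨
      ((if ε i then (1 : ℤ) else 0) - (if ε₁ i then (1 : ℤ) else 0)) = 1 := by
  cases ε i <;> cases ε₁ i <;> simp

/-- The offsets `[ε] − [ε₁]` are in `[−1, 1]`. [folklore] -/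
theorem corner_offset_bounds (ε₁ ε : Fin P.d → Bool) (i : Fin P.d) :
    -1 ≤ ((if ε i then (1 : ℤ) else 0) - (if ε₁ i then (1 : ℤ) else 0)) ∧
      ((if ε i then (1 : ℤ) else 0) - (if ε₁ i then (1 : ℤ) else 0)) ≤ 1 := by
  cases ε i <;> cases ε₁ i <;> simp

/-- The corner as `root + offset` (function form). [folklore] -/
theorem corner_eq_root_add (z₀ : Site P k) (ε₁ ε : Fin P.d → Bool) :
    (fun i => (z₀ i + (if ε i then 1 else 0) : ZMod (P.sitesPerDir k))) =
      fun i => (z₀ i + (if ε₁ i then 1 else 0)) +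
        ((((if ε i then (1 : ℤ) else 0) - (if ε₁ i then (1 : ℤ) else 0) : ℤ)) : ZMod (P.sitesPerDir k)) :=
  funext fun i => corner_offset z₀ ε₁ ε i

/-- Shifting a corner with `ε_μ = 0` gives the corner `ε[μ ↦ 1]`. [folklore] -/
theorem shift_corner (z₀ : Site P k) (ε : Fin P.d → Bool) (μ : Fin P.d) (hε : ε μ = false) :
    Site.shift (fun i => (z₀ i + (if ε i then 1 else 0) : ZMod (P.sitesPerDir k))) μ =
      fun i => (z₀ i + (if Function.update ε μ true i then 1 else 0) : ZMod (P.sitesPerDir k)) := by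
  funext i
  by_cases hi : i = μ
  · subst hi; simp [Site.shift, hε]
  · simp [Site.shift, Function.update_of_ne hi]

/-! ## §2 Size and one-edge differences of the corner potentials -/

/-- `dist1 U_r(z₀+ε) ≤ d·(X + w)` for a corner root `r = z₀ + ε₁` whose unit cube is `X`∕`w`-good. [folklore] -/
theorem dist1_cornerPotential_le (Gf : GaugeField P k (Matrix.specialUnitaryGroup n ℂ))
    (κ : GaugeTransf P k (Matrix.specialUnitaryGroup n ℂ)) (z₀ : Site P k) (ε₁ ε : Fin P.d → Bool) {X w : ℝ} (hX0 : 0 ≤ X)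
    (hw0 : 0 ≤ w)
    (hb : ∀ c : PBond P k,
      (∀ i, ∃ e : ℤ, -1 ≤ e ∧ e ≤ 1 ∧ c.src i = (z₀ i + (if ε₁ i then 1 else 0)) + ((e : ℤ) : ZMod (P.sitesPerDir k))) →
      (∀ i, ∃ e : ℤ, -1 ≤ e ∧ e ≤ 1 ∧ c.tgt i = (z₀ i + (if ε₁ i then 1 else 0)) + ((e : ℤ) : ZMod (P.sitesPerDir k))) →
        dist1 (Gf c) ≤ X ∧ dist1 (GaugeField.gaugeAct κ Gf c) ≤ w) :
    dist1 ((κ (fun i => z₀ i + (if ε₁ i then 1 else 0)))⁻¹ * κ (fun i => z₀ i + (if ε i then 1 else 0))) ≤ P.d * (X + w) := by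
  rw [corner_eq_root_add z₀ ε₁ ε]
  refine dist1_potential_le Gf κ _ _ (fun i => corner_offset_cases ε₁ ε i)
    {s | ∀ i, ∃ e : ℤ, -1 ≤ e ∧ e ≤ 1 ∧ s i = (z₀ i + (if ε₁ i then 1 else 0)) + ((e : ℤ) : ZMod (P.sitesPerDir k))}
    (fun m i => stair_mem_cube _ _ (fun i => corner_offset_bounds ε₁ ε i) m i) hX0 hw0 (fun c hs ht => hb c hs ht)

/-- ★ **ONE CELL EDGE**: `‖glog U_r(z₀ + ε[μ↦1]) − glog U_r(z₀ + ε)‖ ≤ q + 2q² + 4(Y + q)²` (`q = X + 2w`, `Y = d(X+w)`), `ε_μ = 0`. [folklore] -/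
theorem norm_glog_corner_edge_sub_le (Gf : GaugeField P k (Matrix.specialUnitaryGroup n ℂ))
    (κ : GaugeTransf P k (Matrix.specialUnitaryGroup n ℂ)) (z₀ : Site P k) (ε₁ ε : Fin P.d → Bool) (μ : Fin P.d) (hε : ε μ = false)
    {X w : ℝ} (hX0 : 0 ≤ X) (hw0 : 0 ≤ w) (hsmall : 8 * ((P.d : ℝ) + 1) * (X + w) ≤ 1 / 10)
    (hb : ∀ c : PBond P k,
      (∀ i, ∃ e : ℤ, -1 ≤ e ∧ e ≤ 1 ∧ c.src i = (z₀ i + (if ε₁ i then 1 else 0)) + ((e : ℤ) : ZMod (P.sitesPerDir k))) →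
      (∀ i, ∃ e : ℤ, -1 ≤ e ∧ e ≤ 1 ∧ c.tgt i = (z₀ i + (if ε₁ i then 1 else 0)) + ((e : ℤ) : ZMod (P.sitesPerDir k))) →
        dist1 (Gf c) ≤ X ∧ dist1 (GaugeField.gaugeAct κ Gf c) ≤ w) :
    ‖(if ‖(((κ (fun i => z₀ i + (if ε₁ i then 1 else 0)))⁻¹ *
            κ (fun i => z₀ i + (if Function.update ε μ true i then 1 else 0)) : Matrix.specialUnitaryGroup n ℂ) : Matrix n n ℂ) - 1‖ < 1 / 3
        then mlog (((κ (fun i => z₀ i + (if ε₁ i then 1 else 0)))⁻¹ *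
            κ (fun i => z₀ i + (if Function.update ε μ true i then 1 else 0)) : Matrix.specialUnitaryGroup n ℂ) : Matrix n n ℂ) else 0) -
      (if ‖(((κ (fun i => z₀ i + (if ε₁ i then 1 else 0)))⁻¹ *
            κ (fun i => z₀ i + (if ε i then 1 else 0)) : Matrix.specialUnitaryGroup n ℂ) : Matrix n n ℂ) - 1‖ < 1 / 3
        then mlog (((κ (fun i => z₀ i + (if ε₁ i then 1 else 0)))⁻¹ *
            κ (fun i => z₀ i + (if ε i then 1 else 0)) : Matrix.specialUnitaryGroup n ℂ) : Matrix n n ℂ) else 0)‖ ≤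
      (X + 2 * w) + 2 * (X + 2 * w) ^ 2 + 4 * (P.d * (X + w) + (X + 2 * w)) ^ 2 := by
  -- the edge as a coarse bond rooted at the corner `ε`
  set r : Site P k := fun i => z₀ i + (if ε₁ i then 1 else 0) with hr
  set e : PBond P k := ⟨fun i => z₀ i + (if ε i then 1 else 0), μ⟩ with he
  have htgt : e.tgt = fun i => (z₀ i + (if Function.update ε μ true i then 1 else 0) : ZMod (P.sitesPerDir k)) := by
    rw [PBond.tgt, he]; exact shift_corner z₀ ε μ hε
  have hid := potential_tgt_eq Gf κ r e
  rw [htgt] at hid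
  have hsrc : e.src = fun i => (z₀ i + (if ε i then 1 else 0) : ZMod (P.sitesPerDir k)) := by rw [he]
  -- hypotheses on the edge
  have hes : ∀ i, ∃ a : ℤ, -1 ≤ a ∧ a ≤ 1 ∧ e.src i = r i + ((a : ℤ) : ZMod (P.sitesPerDir k)) := fun i =>
    ⟨_, (corner_offset_bounds ε₁ ε i).1, (corner_offset_bounds ε₁ ε i).2, by rw [hsrc]; exact corner_offset z₀ ε₁ ε i⟩
  have het : ∀ i, ∃ a : ℤ, -1 ≤ a ∧ a ≤ 1 ∧ e.tgt i = r i + ((a : ℤ) : ZMod (P.sitesPerDir k)) := fun i =>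
    ⟨_, (corner_offset_bounds ε₁ _ i).1, (corner_offset_bounds ε₁ _ i).2, by rw [htgt]; exact corner_offset z₀ ε₁ _ i⟩
  obtain ⟨hX, hw⟩ := hb e hes het
  have hU : dist1 ((κ r)⁻¹ * κ e.src) ≤ P.d * (X + w) := by
    rw [hsrc]; exact dist1_cornerPotential_le Gf κ z₀ ε₁ ε hX0 hw0 hb
  have hd1 : (1 : ℝ) ≤ P.d := by exact_mod_cast P.hd
  have hY : (P.d : ℝ) * (X + w) ≤ 1 / 10 := by nlinarith
  have hq : X + 2 * w ≤ 1 / 10 := by nlinarith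
  have key := norm_glog_edge_sub_le (U := (κ r)⁻¹ * κ e.src) (M := (κ e.src)⁻¹ * (GaugeField.gaugeAct κ Gf e)⁻¹ * κ e.src)
    (g := Gf e) hU hY (by rw [dist1_inv_mul_inv_mul]; exact hw) hX hq hw0
  rw [← hid, hsrc] at key
  exact key

/-! ## §3 Change of root along a cell edge -/

/-- `(y + e_μ) − e_μ = y`. [folklore] -/
theorem unshift_shift (y : Site P k) (μ : Fin P.d) : Site.unshift (Site.shift y μ) μ = y := by
  funext i
  by_cases hi : i = μ
  · subst hi; simp [Site.shift, Site.unshift]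
  · simp [Site.shift, Site.unshift, Function.update_of_ne hi]

/-- ★ **CHANGE OF ROOT** along the edge `r = z₀ + ε₁ → r' = z₀ + ε₁[μ↦1]` (`ε₁_μ = 0`): for every corner `z = z₀ + ε`,
`‖glog U_r(z) − glog U_r(r') − glog U_{r'}(z)‖ ≤ 2ω + 4(p₀ + (ω + Y + ωY))² + 4(ω + Y)²` with `p₀ = X + w`, `ω = 2dw`, `Y = d(X+w)`. [folklore] -/
theorem norm_glog_corner_root_change_le (Gf : GaugeField P k (Matrix.specialUnitaryGroup n ℂ))
    (κ : Site P k → GaugeTransf P k (Matrix.specialUnitaryGroup n ℂ)) (z₀ : Site P k) (ε₁ ε : Fin P.d → Bool) (μ : Fin P.d)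
    (hε₁ : ε₁ μ = false) {X w : ℝ} (hX0 : 0 ≤ X) (hw0 : 0 ≤ w) (hsmall : 8 * ((P.d : ℝ) + 1) * (X + w) ≤ 1 / 10)
    (hb : ∀ ε₂ : Fin P.d → Bool, ∀ c : PBond P k,
      (∀ i, ∃ e : ℤ, -1 ≤ e ∧ e ≤ 1 ∧ c.src i = (z₀ i + (if ε₂ i then 1 else 0)) + ((e : ℤ) : ZMod (P.sitesPerDir k))) →
      (∀ i, ∃ e : ℤ, -1 ≤ e ∧ e ≤ 1 ∧ c.tgt i = (z₀ i + (if ε₂ i then 1 else 0)) + ((e : ℤ) : ZMod (P.sitesPerDir k))) →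
        dist1 (Gf c) ≤ X ∧ dist1 (GaugeField.gaugeAct (κ (fun i => z₀ i + (if ε₂ i then 1 else 0))) Gf c) ≤ w) :
    let r : Site P k := fun i => z₀ i + (if ε₁ i then 1 else 0)
    let r' : Site P k := fun i => z₀ i + (if Function.update ε₁ μ true i then 1 else 0)
    let z : Site P k := fun i => z₀ i + (if ε i then 1 else 0)
    ‖(if ‖(((κ r r)⁻¹ * κ r z : Matrix.specialUnitaryGroup n ℂ) : Matrix n n ℂ) - 1‖ < 1 / 3
        then mlog (((κ r r)⁻¹ * κ r z : Matrix.specialUnitaryGroup n ℂ) : Matrix n n ℂ) else 0) -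
      (if ‖(((κ r r)⁻¹ * κ r r' : Matrix.specialUnitaryGroup n ℂ) : Matrix n n ℂ) - 1‖ < 1 / 3
        then mlog (((κ r r)⁻¹ * κ r r' : Matrix.specialUnitaryGroup n ℂ) : Matrix n n ℂ) else 0) -
      (if ‖(((κ r' r')⁻¹ * κ r' z : Matrix.specialUnitaryGroup n ℂ) : Matrix n n ℂ) - 1‖ < 1 / 3
        then mlog (((κ r' r')⁻¹ * κ r' z : Matrix.specialUnitaryGroup n ℂ) : Matrix n n ℂ) else 0)‖ ≤
      2 * (2 * P.d * w) + 4 * ((X + w) + ((2 * P.d * w) + P.d * (X + w) + (2 * P.d * w) * (P.d * (X + w)))) ^ 2 +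
        4 * ((2 * P.d * w) + P.d * (X + w)) ^ 2 := by
  intro r r' z
  have hd1 : (1 : ℝ) ≤ P.d := by exact_mod_cast P.hd
  -- the three group elements
  set U₀ : Matrix.specialUnitaryGroup n ℂ := (κ r r)⁻¹ * κ r r' with hU₀
  set D : Matrix.specialUnitaryGroup n ℂ := (κ r' r')⁻¹ * κ r' z with hD
  set C : Matrix.specialUnitaryGroup n ℂ := (κ r r')⁻¹ * κ r z with hC
  set Q : Matrix.specialUnitaryGroup n ℂ := C * D⁻¹ with hQ
  have hfac : (κ r r)⁻¹ * κ r z = U₀ * (Q * D) := by rw [hQ, hU₀, hC, hD]; group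
  rw [hfac]
  -- sizes
  have hr'shift : r' = Site.shift r μ := (shift_corner z₀ ε₁ μ hε₁).symm
  -- (a) `dist1 U₀ ≤ X + w`: the root edge
  set e₀ : PBond P k := ⟨r, μ⟩ with he₀
  have htgt₀ : e₀.tgt = r' := by rw [PBond.tgt, he₀, hr'shift]
  have hid₀ := potential_tgt_eq Gf (κ r) r e₀
  rw [htgt₀] at hid₀
  have hsrc₀ : e₀.src = r := by rw [he₀]
  have he₀s : ∀ i, ∃ a : ℤ, -1 ≤ a ∧ a ≤ 1 ∧ e₀.src i = r i + ((a : ℤ) : ZMod (P.sitesPerDir k)) := fun i =>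
    ⟨0, by norm_num, by norm_num, by rw [hsrc₀]; simp⟩
  have he₀t : ∀ i, ∃ a : ℤ, -1 ≤ a ∧ a ≤ 1 ∧ e₀.tgt i = r i + ((a : ℤ) : ZMod (P.sitesPerDir k)) := fun i =>
    ⟨_, (corner_offset_bounds ε₁ _ i).1, (corner_offset_bounds ε₁ _ i).2, by rw [htgt₀]; exact corner_offset z₀ ε₁ _ i⟩
  obtain ⟨hX₀, hw₀⟩ := hb ε₁ e₀ he₀s he₀t
  have hU₀le : dist1 U₀ ≤ X + w := by
    rw [hU₀, hid₀, hsrc₀, inv_mul_cancel, one_mul]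
    refine (GaugeGroup.dist1_mul_le _ _).trans ?_
    rw [dist1_inv_mul_inv_mul]; linarith
  -- (b) `dist1 D ≤ Y`
  have hDle : dist1 D ≤ P.d * (X + w) := by
    rw [hD]; exact dist1_cornerPotential_le Gf (κ r') z₀ _ ε hX0 hw0 (hb _)
  -- (c) `dist1 Q ≤ 2dw`: the two gauges `κ r`, `κ r'` rooted at `r'`, staircase inside both unit cubes
  have hQle : dist1 Q ≤ 2 * P.d * w := by
    rw [hQ, hC, hD]
    have hz : z = fun i => r' i + ((((if ε i then (1 : ℤ) else 0) - (if Function.update ε₁ μ true i then (1 : ℤ) else 0) : ℤ)) :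
        ZMod (P.sitesPerDir k)) := corner_eq_root_add z₀ _ ε
    rw [hz]
    have hδμ : ((if ε μ then (1 : ℤ) else 0) - (if Function.update ε₁ μ true μ then (1 : ℤ) else 0)) ≤ 0 := by
      simp only [Function.update_self, if_true]; split_ifs <;> norm_num
    refine dist1_potential_mul_inv_potential_le Gf (κ r) (κ r') r' _ (fun i => corner_offset_cases _ ε i)
      {s | (∀ i, ∃ a : ℤ, -1 ≤ a ∧ a ≤ 1 ∧ s i = r i + ((a : ℤ) : ZMod (P.sitesPerDir k))) ∧
        (∀ i, ∃ a : ℤ, -1 ≤ a ∧ a ≤ 1 ∧ s i = r' i + ((a : ℤ) : ZMod (P.sitesPerDir k)))}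
      (fun m => ⟨fun i => ?_, fun i => stair_mem_cube r' _ (fun i => corner_offset_bounds _ ε i) m i⟩) hw0
      (fun c hs ht => ⟨(hb ε₁ c hs.1 ht.1).2, (hb _ c hs.2 ht.2).2⟩)
    -- the staircase from `r'` stays in the cube around `r = r' − e_μ` since its `μ`-offset is `≤ 0`
    obtain ⟨a, ha1, ha2, ha⟩ := stair_mem_cube_unshift r' _ (fun i => corner_offset_bounds _ ε i) μ hδμ m i
    refine ⟨a, ha1, ha2, ?_⟩
    beta_reduce
    rw [ha, hr'shift, unshift_shift]
  -- (d) the analytic letter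
  have hsum : (X + w) + 2 * (2 * P.d * w) + 2 * (P.d * (X + w)) ≤ 1 / 10 := by nlinarith
  exact norm_glog_root_change_le hU₀le hQle hDle hsum

/-! ## §4 The root edge -/

/-- **THE ROOT EDGE**: `G⟨r, μ⟩ = M⁻¹·U_r(r + e_μ)` with `dist1 M ≤ w`, and `dist1 U_r(r + e_μ) ≤ X + w`. [folklore] -/
theorem exists_rootEdge_factor (Gf : GaugeField P k (Matrix.specialUnitaryGroup n ℂ))
    (κr : GaugeTransf P k (Matrix.specialUnitaryGroup n ℂ)) (r : Site P k) (μ : Fin P.d) {X w : ℝ}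
    (hX : dist1 (Gf ⟨r, μ⟩) ≤ X) (hw : dist1 (GaugeField.gaugeAct κr Gf ⟨r, μ⟩) ≤ w) :
    ∃ M : Matrix.specialUnitaryGroup n ℂ, dist1 M ≤ w ∧ Gf ⟨r, μ⟩ = M⁻¹ * ((κr r)⁻¹ * κr (Site.shift r μ)) ∧
      dist1 ((κr r)⁻¹ * κr (Site.shift r μ)) ≤ X + w := by
  have hid := potential_tgt_eq Gf κr r ⟨r, μ⟩
  have htgt : PBond.tgt ⟨r, μ⟩ = Site.shift r μ := rfl
  rw [htgt] at hid
  change (κr r)⁻¹ * κr (Site.shift r μ) = (κr r)⁻¹ * κr r * _ * _ at hid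
  rw [inv_mul_cancel, one_mul] at hid
  refine ⟨(κr r)⁻¹ * (GaugeField.gaugeAct κr Gf ⟨r, μ⟩)⁻¹ * κr r, ?_, ?_, ?_⟩
  · rw [dist1_inv_mul_inv_mul]; exact hw
  · rw [hid]; group
  · rw [hid]
    refine (GaugeGroup.dist1_mul_le _ _).trans ?_
    rw [dist1_inv_mul_inv_mul]; linarith

end Summit.QuantumFields.YangMills.Theorems.PoincareLipschitzHierAlignCornerData

end
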